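import Literature.NumberTheory.EllipticCurves.MatarNekovar2019.IrreducibleOverQuadraticFieldProofs
import Literature.NumberTheory.EllipticCurves.CastellaGrossiLeeSkinner2022.HowardDivisibilityAnyClassNumber
import HarnessLib

/-!
# Schur's lemma for `E[p]` over a quadratic field `K` at a good ORDINARY prime `p ∤ 2 d_K`:
# `E[p]` irreducible over `K` ⇒ `E[p]` ABSOLUTELY irreducible over `K` (its `Γ_K`-commutant is `𝔽_p`)

`Proofs`-style file (THEOREMS ONLY: no definition, no named fact, no instance), topic
`NumberTheory/EllipticCurves`.

## What is proved

For an elliptic curve `E/ℚ` (global minimal model `W`), an odd prime `p` of good ORDINARY reduction,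
and a quadratic field `K` in which `p` is UNRAMIFIED (`p ∤ d_K`): if `E[p]` is irreducible as an
`𝔽_p[Γ_K]`-module (`(W.baseChange K).HasIrreducibleModPGaloisRep p`), then every `Γ_K`-equivariant
additive endomorphism of `E[p] = E_K(K̄)[p]` is multiplication by an integer — i.e.
`End_{𝔽_p[Γ_K]}(E[p]) = 𝔽_p`, which for a finite-dimensional representation over the finite field `𝔽_p`
is ABSOLUTE irreducibility (Schur; Curtis–Reiner (29.13)/(3.43): an irreducible `kG`-module `V` is
absolutely irreducible iff `End_{kG}(V) = k`). Main statements: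

* `exists_forall_eq_zsmul_of_irreducible_of_eigenline` — the abstract device: an irreducible module for
  a set `H` of operators, ONE operator `τ ∈ H` having an eigenvalue `a` whose FULL eigenspace is a cyclic
  line `ℤ v₀`; then every `H`-equivariant endomorphism `φ` is a scalar (`φ v₀` lies on the line, say
  `φ v₀ = c v₀`, and `ker (φ − c)` is a non-zero `H`-stable subgroup).
* `exists_forall_eq_zsmul_of_ordinary_of_inertia_le` — `Γ_ℚ`-currency: for `H ≤ Γ_ℚ` containing an
  inertia group `I_𝔓`, `𝔓 ∣ p` a prime of `\bar ℤ`, `p` odd good ordinary, and `E[p]` `H`-irreducible,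
  every `H`-equivariant endomorphism of `E[p]` is a scalar. The operator is Serre's inertia element:
  by Serre 1972 §1.11 Prop. 11 and Cor. (tree `MatarNekovar2019.exists_ordinaryLine`) `I_𝔓` acts on
  `E[p]` through `(χ ∗; 0 1)` on the ordinary line `X = ℤ v₀` with `χ(I_𝔓) = 𝔽_pˣ`; take `τ` with
  `χ(τ) = −1` (`≠ 1` as `p` is odd): its `(−1)`-eigenspace is exactly `X` (if `τ y = −y` then
  `−2y = τ y − y ∈ X`, and `2` is invertible mod `p`).
* `exists_forall_eq_zsmul_baseChange_of_ordinary` — `K`-currency, `K` quadratic with `p ∤ d_K`: the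
  inertia groups at `p` lie in `Gal(ℚ̄/K)` (tree `inertia_le_range_absGaloisRestrict`), and `E(ℚ̄)[p] ≃
  E_K(K̄)[p]` equivariantly along `Γ_K → Γ_ℚ` (tree `exists_addEquiv_geomPoints_baseChange`;
  `exists_addEquiv_geomTorsion_baseChange` below).
* `CastellaGrossiLeeSkinner2022.Thm413Hypotheses.exists_forall_eq_zsmul_of_hasIrreducibleModPGaloisRep`
  — the same read off the standing hypotheses of CGLS 2022 Thm. 4.1.3 (`p ∤ 2`, good ordinary,
  `K` imaginary quadratic with `p ∤ d_K`) plus `(irr_K)`.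

## Why this file exists (cell `pub/bsd-print-x9`, rows 9/10; seat `bsd-line-x10b-p1-w2` g4, 2026-08-28)

Howard's abstract `Λ`-adic Kolyvagin-system theorem (Compositio 140 (2004), Thm. 2.2.10, hypotheses
H.0–H.5 of §1.3/§2.1) asks in H.1 that the residual representation be ABSOLUTELY irreducible over `K`;
the cell's one residual item of rows 9/10 (`HeegnerMuPartStabilized.MuPartStabilizedOfPrint`, the
`μ`-part of the Heegner-point containment at `p ∣ h_K`) carries only `(irr_K)` among its binders, next
to `Thm413Hypotheses` (which includes `p ∤ d_K`, good ordinary, `p` odd). This file shows that on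
EVERY frame of that letter H.1 holds — in particular the sub-locus "`ρ̄(G_K)` inside a non-split Cartan"
feared for `p = 3` (x9-p1 LEAD g2, LINE-REPORT §3 "X10b caveat") is empty: a non-split Cartan contains
no non-scalar element with an `𝔽_p`-rational eigenvalue, while `ρ̄(G_K) ⊇ ρ̄(I_p) ∋ diag(−1, 1)`.
No image hypothesis (surjective / normaliser of Cartan / `S₄`) and no bound on `p` beyond `p ≠ 2` is
used. «beyond-print theorem»: no (textbook Schur + Serre Prop. 11). BSD is NOT proved by this file.

References: J.-P. Serre, Invent. Math. 15 (1972), §1.11 Prop. 11 and Cor. [Serre1972];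
A. Matar, J. Nekovář, JTNB 31 (2019), proof of Prop. 5.26 (2) (the same inertia device) [MatarNekovar2019];
B. Howard, Compositio Math. 140 (2004), §1.3 hypothesis H.1 [Howard2004HeegnerKolyvagin];
F. Castella, G. Grossi, J. Lee, C. Skinner, Invent. Math. 227 (2022), §3.2/§4.1 standing hypotheses
[CastellaGrossiLeeSkinner2022].
-/

set_option autoImplicit false

noncomputable section

open scoped Classical NumberField Pointwise

open WeierstrassCurve Field IsDedekindDomain NumberField Rat.HeightOneSpectrum
  Literature.NumberTheory.EllipticCurves Literature.NumberTheory.GaloisRepresentations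

universe u

namespace Literature.NumberTheory.EllipticCurves

/-! ### §1 Schur's lemma from one cyclic eigenline (abstract) -/

section Abstract

variable {M V : Type*} [Monoid M] [AddCommGroup V] [DistribMulAction M V]

/-- **Schur's lemma from one cyclic eigenline.** Let a monoid `M` act on an abelian group `V`, and let
`H ⊆ M` act irreducibly (the only `H`-stable subgroups are `⊥` and `⊤`). Suppose some `τ ∈ H` and
`v₀ ≠ 0` satisfy `τ v₀ = a v₀` and the FULL `a`-eigenspace of `τ` is contained in the line `ℤ v₀`.
Then every `H`-equivariant additive endomorphism `φ` of `V` is multiplication by an integer: `φ v₀` is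
again an `a`-eigenvector, so `φ v₀ = c v₀`, and `{P | φ P = c P}` is an `H`-stable subgroup containing
`v₀ ≠ 0`, hence everything. This is Schur's lemma (Lang, *Algebra*, Ch. XVII §1, Prop. 1.1: the
commutant of a simple module is a division ring; here the eigenline pins it to the prime ring) in the
eigenline form used for `E[p]` at an ordinary prime below.
[cite: Lang2002, Ch. XVII §1 Prop. 1.1 (Schur's lemma)] -/
theorem exists_forall_eq_zsmul_of_irreducible_of_eigenline (H : Set M)
    (hirr : ∀ Φ : AddSubgroup V, (∀ σ ∈ H, ∀ P ∈ Φ, σ • P ∈ Φ) → Φ = ⊥ ∨ Φ = ⊤)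
    {τ : M} (hτ : τ ∈ H) {v₀ : V} (hv₀ : v₀ ≠ 0) {a : ℤ} (hτv₀ : τ • v₀ = a • v₀)
    (heig : ∀ y : V, τ • y = a • y → y ∈ AddSubgroup.zmultiples v₀)
    (φ : V →+ V) (hφ : ∀ σ ∈ H, ∀ P : V, φ (σ • P) = σ • φ P) :
    ∃ c : ℤ, ∀ P : V, φ P = c • P := by
  have hsmulz : ∀ (σ : M) (n : ℤ) (x : V), σ • (n • x) = n • (σ • x) := fun σ n x ↦
    map_zsmul (DistribSMul.toAddMonoidHom V σ) n x
  -- `φ v₀` is an `a`-eigenvector of `τ`, hence on the line `ℤ v₀`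
  have h1 : τ • φ v₀ = a • φ v₀ := by rw [← hφ τ hτ, hτv₀, map_zsmul]
  obtain ⟨c, hc⟩ := AddSubgroup.mem_zmultiples_iff.mp (heig _ h1)
  refine ⟨c, ?_⟩
  -- the `H`-stable subgroup `{P | φ P = c • P}`
  let Φ : AddSubgroup V :=
    { carrier := {P | φ P = c • P}
      add_mem' := fun {x y} hx hy ↦ by
        simp only [Set.mem_setOf_eq] at hx hy ⊢
        rw [map_add, hx, hy, smul_add]
      zero_mem' := by simp
      neg_mem' := fun {x} hx ↦ by
        simp only [Set.mem_setOf_eq] at hx ⊢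
        rw [map_neg, hx, smul_neg] }
  have hΦstab : ∀ σ ∈ H, ∀ P ∈ Φ, σ • P ∈ Φ := by
    intro σ hσ P hP
    change φ P = c • P at hP
    change φ (σ • P) = c • (σ • P)
    rw [hφ σ hσ, hP, hsmulz]
  have hv₀Φ : v₀ ∈ Φ := by
    change φ v₀ = c • v₀
    exact hc.symm
  have hΦtop : Φ = ⊤ := by
    rcases hirr Φ hΦstab with h | h
    · exact absurd ((AddSubgroup.eq_bot_iff_forall _).mp h v₀ hv₀Φ) hv₀
    · exact h
  intro P
  have hP : P ∈ Φ := by rw [hΦtop]; exact AddSubgroup.mem_top P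
  exact hP

end Abstract

/-! ### §2 `E[p]` at a good ordinary odd `p`, `Γ_ℚ`-currency -/

section Rational

variable {W : WeierstrassCurve ℚ} [W.IsElliptic] [W.IsGloballyMinimal] {p : ℕ} [Fact p.Prime]

/-- **The `Γ_K`-commutant of `E[p]` is `𝔽_p` once `Γ_K` contains an inertia group at a good ordinary
odd `p`** (`Γ_ℚ`-currency). Let `H ≤ Γ_ℚ` contain the inertia group `I_𝔓` of a prime `𝔓 ∣ p` of
`\bar ℤ`, `p ≠ 2` of good ordinary reduction, and let `E[p]` be `H`-irreducible. Then every
`H`-equivariant additive endomorphism of `E[p]` is multiplication by an integer. Proof: Serre's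
Prop. 11 (tree `MatarNekovar2019.exists_ordinaryLine`) gives the ordinary line `X = ℤ v₀` with
`τ x − x ∈ X` for all `τ ∈ I_𝔓` and some `τ ∈ I_𝔓` with `τ v₀ = −v₀`; if `τ y = −y` then
`−2 y = τ y − y ∈ X`, so `y ∈ X` (`p` odd): the `(−1)`-eigenspace of `τ` is the line `X`, and §1
applies. In particular `E[p]` is absolutely irreducible over `ℚ̄^H` (Schur).
[cite: Serre1972, §1.11 Prop. 11 and Cor.] -/
theorem exists_forall_eq_zsmul_of_ordinary_of_inertia_le (hp2 : p ≠ 2)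
    (hgood : W.HasGoodReductionAtPrime p) (hord : ¬ (p : ℤ) ∣ W.frobeniusTrace p)
    {v : HeightOneSpectrum (𝓞 ℚ)} (hv : (primesEquiv v : ℕ) = p)
    {𝔓 : Ideal (absIntegers (𝓞 ℚ) ℚ)} (h𝔓 : 𝔓 ∈ v.primesAbove)
    {H : Subgroup (absoluteGaloisGroup ℚ)} (hI : 𝔓.inertia (absoluteGaloisGroup ℚ) ≤ H)
    (hirr : ∀ Φ : AddSubgroup (geomTorsion W (p : ℤ)),
      (∀ σ ∈ H, ∀ P ∈ Φ, σ • P ∈ Φ) → Φ = ⊥ ∨ Φ = ⊤)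
    (φ : geomTorsion W (p : ℤ) →+ geomTorsion W (p : ℤ))
    (hφ : ∀ σ ∈ H, ∀ P : geomTorsion W (p : ℤ), φ (σ • P) = σ • φ P) :
    ∃ c : ℤ, ∀ P : geomTorsion W (p : ℤ), φ P = c • P := by
  have hp : p.Prime := Fact.out
  have hpi : Prime (p : ℤ) := Nat.prime_iff_prime_int.mp hp
  have hptor : ∀ P : geomTorsion W (p : ℤ), ((p : ℕ) : ℤ) • P = 0 := fun P ↦ by
    rw [← Subtype.coe_inj, AddSubgroupClass.coe_zsmul, ZeroMemClass.coe_zero]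
    exact (Submodule.mem_torsionBy_iff _ _).mp P.2
  obtain ⟨v₀, hv₀, hline, hchar⟩ := MatarNekovar2019.exists_ordinaryLine hgood hord hv h𝔓
  -- `p ∤ -1` and `p ∤ -2`
  have hm1 : ¬ (p : ℤ) ∣ (-1) := by
    intro h
    have h1 : (p : ℤ) = 1 := Int.eq_one_of_dvd_one (Int.natCast_nonneg p) (dvd_neg.mp h)
    exact hp.one_lt.ne' (by exact_mod_cast h1)
  have hm2 : ¬ (p : ℤ) ∣ (-2) := by
    intro h
    have h2 : (p : ℕ) ∣ 2 := by exact_mod_cast (dvd_neg.mp h)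
    exact hp2 ((Nat.prime_dvd_prime_iff_eq hp Nat.prime_two).mp h2)
  -- Serre's inertia element with eigenvalue `-1` on the ordinary line
  obtain ⟨τ, hτ, hτv₀⟩ := hchar (-1) hm1
  refine exists_forall_eq_zsmul_of_irreducible_of_eigenline (H : Set (absoluteGaloisGroup ℚ))
    (fun Φ hΦ ↦ hirr Φ hΦ) (hI hτ) hv₀ hτv₀ ?_ φ (fun σ hσ P ↦ hφ σ hσ P)
  -- the `(-1)`-eigenspace of `τ` is the line `ℤ v₀`
  intro y hy
  obtain ⟨n, hn⟩ := hline τ hτ y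
  have h2 : (-2 : ℤ) • y = n • v₀ := by
    rw [← hn, hy]
    module
  obtain ⟨α, β, hαβ⟩ := (hpi.coprime_iff_not_dvd.mpr hm2).symm
  refine AddSubgroup.mem_zmultiples_iff.mpr ⟨α * n, ?_⟩
  calc (α * n) • v₀ = α • ((-2 : ℤ) • y) := by rw [h2, smul_smul]
    _ = (α * (-2) + β * (p : ℤ)) • y := by
        rw [add_smul, smul_smul, mul_smul β, hptor, smul_zero, add_zero]
    _ = y := by rw [hαβ, one_smul]

end Rational

/-! ### §3 `K`-currency: quadratic `K` with `p ∤ d_K` -/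

section BaseChange

variable (W : WeierstrassCurve ℚ) (K : Type) [Field K] [NumberField K]

/-- **`E(ℚ̄)[n] ≃ E_K(K̄)[n]` equivariantly along `Γ_K → Γ_ℚ`**: the restriction to `n`-torsion of the
tree's `exists_addEquiv_geomPoints_baseChange` (points along the chosen embedding `ℚ̄ → K̄`): the
`Γ_K`-module `E_K[n]` is the restriction of the `Γ_ℚ`-module `E[n]` (Silverman, *AEC*, III.§7, the Galois
representation on `E[m]`, and VIII.§1). [cite: SilvermanAEC2009, III.§7 (the action of G_{K̄/K} on E[m]) and VIII.§1] -/
theorem exists_addEquiv_geomTorsion_baseChange (n : ℤ) :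
    ∃ ψ : geomTorsion W n ≃+ geomTorsion (W.baseChange K) n,
      ∀ (γ : absoluteGaloisGroup K) (T : geomTorsion W n),
        ψ (absGaloisRestrict ℚ K γ • T) = γ • ψ T := by
  obtain ⟨e, he⟩ := W.exists_addEquiv_geomPoints_baseChange K
  have hmem : ∀ T : geomTorsion W n, e T ∈ geomTorsion (W.baseChange K) n := by
    intro T
    have hT : n • (T : W.geomPoints) = 0 := (Submodule.mem_torsionBy_iff _ _).mp T.2
    change e T ∈ Submodule.torsionBy ℤ _ n
    rw [Submodule.mem_torsionBy_iff]
    change n • e T = 0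
    rw [← map_zsmul, hT, map_zero]
  let φ : geomTorsion W n →+ geomTorsion (W.baseChange K) n :=
    AddMonoidHom.codRestrict ((e : W.geomPoints →+ (W.baseChange K).geomPoints).comp
      (geomTorsion W n).subtype) (geomTorsion (W.baseChange K) n) hmem
  have hφ : ∀ T, ((φ T : geomTorsion (W.baseChange K) n) : (W.baseChange K).geomPoints) = e T :=
    fun T ↦ rfl
  have hφinj : Function.Injective φ := by
    intro T₁ T₂ h
    have h' := congrArg (fun x : geomTorsion (W.baseChange K) n ↦
      (x : (W.baseChange K).geomPoints)) h
    simp only [hφ] at h'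
    exact Subtype.ext (e.injective h')
  have hφsurj : Function.Surjective φ := by
    intro S
    have hS : e.symm S ∈ geomTorsion W n := by
      have hS' : n • (S : (W.baseChange K).geomPoints) = 0 :=
        (Submodule.mem_torsionBy_iff _ _).mp S.2
      change e.symm S ∈ Submodule.torsionBy ℤ _ n
      rw [Submodule.mem_torsionBy_iff]
      change n • e.symm (S : (W.baseChange K).geomPoints) = 0
      apply e.injective
      rw [map_zsmul, AddEquiv.apply_symm_apply, map_zero, hS']
    refine ⟨⟨e.symm S, hS⟩, Subtype.ext ?_⟩
    rw [hφ]
    exact e.apply_symm_apply S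
  refine ⟨AddEquiv.ofBijective φ ⟨hφinj, hφsurj⟩, fun γ T ↦ Subtype.ext ?_⟩
  rw [AddEquiv.ofBijective_apply, AddEquiv.ofBijective_apply, AddSubgroup.torsionBy.coe_smul, hφ,
    hφ, AddSubgroup.torsionBy.coe_smul]
  exact he γ T

variable {W K} in
/-- Transport of irreducibility: if `E_K[p]` is `Γ_K`-irreducible then `E(ℚ̄)[p]` is irreducible for
`H = Gal(ℚ̄/K) ≤ Γ_ℚ` (the image of the restriction), along the equivariant isomorphism
`exists_addEquiv_geomTorsion_baseChange` (Silverman, *AEC*, III.§7: `E_K[p]` is the restriction of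
`E[p]` to `G_{K̄/K}`; Matar–Nekovář 2019, proof of Prop. 5.26 (2), first sentence, uses exactly this
transport). [cite: SilvermanAEC2009, III.§7 (the action of G_{K̄/K} on E[m])] -/
theorem irreducible_range_of_hasIrreducibleModPGaloisRep_baseChange {p : ℕ}
    (hirr : (W.baseChange K).HasIrreducibleModPGaloisRep p)
    {ψ : geomTorsion W (p : ℤ) ≃+ geomTorsion (W.baseChange K) (p : ℤ)}
    (hψ : ∀ (γ : absoluteGaloisGroup K) (T : geomTorsion W (p : ℤ)),
      ψ (absGaloisRestrict ℚ K γ • T) = γ • ψ T)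
    (Φ : AddSubgroup (geomTorsion W (p : ℤ)))
    (hΦ : ∀ σ ∈ (absGaloisRestrict ℚ K).range, ∀ P ∈ Φ, σ • P ∈ Φ) : Φ = ⊥ ∨ Φ = ⊤ := by
  have hstab : ∀ (γ : absoluteGaloisGroup K), ∀ Q ∈ Φ.map ψ.toAddMonoidHom,
      γ • Q ∈ Φ.map ψ.toAddMonoidHom := by
    intro γ Q hQ
    obtain ⟨T, hT, rfl⟩ := AddSubgroup.mem_map.mp hQ
    exact AddSubgroup.mem_map.mpr ⟨absGaloisRestrict ℚ K γ • T, hΦ _ ⟨γ, rfl⟩ T hT, hψ γ T⟩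
  have hinj : Function.Injective ψ.toAddMonoidHom := ψ.injective
  rcases hirr (Φ.map ψ.toAddMonoidHom) hstab with h | h
  · left
    exact (AddSubgroup.map_eq_bot_iff_of_injective Φ hinj).mp h
  · right
    rw [← AddSubgroup.comap_map_eq_self_of_injective hinj (H := Φ), h, AddSubgroup.comap_top]

variable {W K} in
/-- **Schur for `E[p]` over a quadratic field `K`, `p ∤ 2 d_K` good ordinary**: if `E_K[p]` is
irreducible (`(W.baseChange K).HasIrreducibleModPGaloisRep p`) then every `Γ_K`-equivariant additive
endomorphism of `E_K[p]` is multiplication by an integer, i.e. `End_{𝔽_p[Γ_K]}(E[p]) = 𝔽_p` — `E[p]` is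
ABSOLUTELY irreducible over `K`. (`p ∤ d_K` puts the inertia groups at `p` inside `Gal(ℚ̄/K)`, tree
`inertia_le_range_absGaloisRestrict`; then §2.) In particular `ρ̄_{E,p}(Γ_K)` is never contained in a
non-split Cartan subgroup under these hypotheses. [cite: Serre1972, §1.11 Prop. 11 and Cor.]
[cite: MatarNekovar2019, proof of Prop. 5.26 (2) (p. 493)] -/
theorem exists_forall_eq_zsmul_baseChange_of_ordinary [W.IsElliptic] [W.IsGloballyMinimal] {p : ℕ}
    [Fact p.Prime] (hp2 : p ≠ 2) (hgood : W.HasGoodReductionAtPrime p)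
    (hord : ¬ (p : ℤ) ∣ W.frobeniusTrace p) (h2 : Module.finrank ℚ K = 2)
    (hunr : ¬ (p : ℤ) ∣ NumberField.discr K)
    (hirr : (W.baseChange K).HasIrreducibleModPGaloisRep p)
    (φ : geomTorsion (W.baseChange K) (p : ℤ) →+ geomTorsion (W.baseChange K) (p : ℤ))
    (hφ : ∀ (γ : absoluteGaloisGroup K) (P : geomTorsion (W.baseChange K) (p : ℤ)),
      φ (γ • P) = γ • φ P) :
    ∃ c : ℤ, ∀ P : geomTorsion (W.baseChange K) (p : ℤ), φ P = c • P := by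
  have hp : p.Prime := Fact.out
  haveI : Algebra.IsQuadraticExtension ℚ K := { finrank_eq_two' := h2 }
  -- the place at `p`, a prime `𝔓 ∣ p` of `\bar ℤ`, and `I_𝔓 ≤ Gal(ℚ̄/K)`
  set v : HeightOneSpectrum (𝓞 ℚ) := primesEquiv.symm ⟨p, hp⟩ with hvdef
  have hv : (primesEquiv v : ℕ) = p := by rw [hvdef, Equiv.apply_symm_apply]
  obtain ⟨𝔓, -, h𝔓⟩ := exists_ideal_placeOver p hv
  have hnd : ¬ ((primesEquiv v : Nat.Primes) : ℕ) ∣ (NumberField.discr K).natAbs := by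
    rw [hv]
    intro h
    exact hunr (Int.natCast_dvd.mpr h)
  have hI : 𝔓.inertia (absoluteGaloisGroup ℚ) ≤ (absGaloisRestrict ℚ K).range :=
    inertia_le_range_absGaloisRestrict ℚ K
      (ModularForms.ramificationIdxIn_eq_one_of_not_dvd_natAbs_discr K v hnd) h𝔓
  -- transport along `E(ℚ̄)[p] ≃ E_K(K̄)[p]`
  obtain ⟨ψ, hψ⟩ := exists_addEquiv_geomTorsion_baseChange W K (p : ℤ)
  have hirr' := irreducible_range_of_hasIrreducibleModPGaloisRep_baseChange hirr hψ
  set χ : geomTorsion W (p : ℤ) →+ geomTorsion W (p : ℤ) :=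
    (ψ.symm.toAddMonoidHom.comp φ).comp ψ.toAddMonoidHom with hχdef
  have hχapply : ∀ T, χ T = ψ.symm (φ (ψ T)) := fun T ↦ rfl
  have hχ : ∀ σ ∈ (absGaloisRestrict ℚ K).range, ∀ T : geomTorsion W (p : ℤ),
      χ (σ • T) = σ • χ T := by
    rintro σ ⟨γ, rfl⟩ T
    rw [hχapply, hχapply]
    apply ψ.injective
    change ψ (ψ.symm (φ (ψ (absGaloisRestrict ℚ K γ • T)))) =
      ψ (absGaloisRestrict ℚ K γ • ψ.symm (φ (ψ T)))
    rw [AddEquiv.apply_symm_apply, hψ, hφ, hψ, AddEquiv.apply_symm_apply]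
  obtain ⟨c, hc⟩ :=
    exists_forall_eq_zsmul_of_ordinary_of_inertia_le hp2 hgood hord hv h𝔓 hI hirr' χ hχ
  refine ⟨c, fun P ↦ ?_⟩
  have h := congrArg ψ (hc (ψ.symm P))
  rw [hχapply, AddEquiv.apply_symm_apply, AddEquiv.apply_symm_apply, map_zsmul,
    AddEquiv.apply_symm_apply] at h
  exact h

end BaseChange

/-! ### §4 Read off the standing hypotheses of CGLS 2022 Thm. 4.1.3 (`Thm413Hypotheses`) -/

/-- **H.1 on the frames of the rows-9/10 residual letter.** Under the standing hypotheses of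
Castella–Grossi–Lee–Skinner 2022 Thm. 4.1.3 (`Thm413Hypotheses N W K p κ γ`: `E` elliptic, `p ∤ 2`, good
ordinary at `p`, `K` imaginary quadratic with `p ∤ d_K`, …) together with `(irr_K)`, every
`Γ_K`-equivariant additive endomorphism of `E_K[p]` is multiplication by an integer: `E[p]` is
ABSOLUTELY irreducible over `K` — Howard's hypothesis H.1 (Compositio 140 (2004), §1.3) for `T = T_pE`
over `K`. No hypothesis on the image of `ρ̄_{E,p}` beyond `(irr_K)`, none on the class number, none on
the splitting of `p` in `K`. [cite: Serre1972, §1.11 Prop. 11 and Cor.]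
[cite: Howard2004HeegnerKolyvagin, §1.3 hypothesis H.1] -/
theorem CastellaGrossiLeeSkinner2022.Thm413Hypotheses.exists_forall_eq_zsmul_of_hasIrreducibleModPGaloisRep
    {N : ℕ} {W : WeierstrassCurve ℚ} [W.IsGloballyMinimal] {K : Type} [Field K] [NumberField K]
    {p : ℕ} [Fact p.Prime] {κ : ZpExtension K p} {γ : Field.absoluteGaloisGroup K}
    (hyp : CastellaGrossiLeeSkinner2022.Thm413Hypotheses N W K p κ γ)
    (hirr : (W.baseChange K).HasIrreducibleModPGaloisRep p)
    (φ : geomTorsion (W.baseChange K) (p : ℤ) →+ geomTorsion (W.baseChange K) (p : ℤ))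
    (hφ : ∀ (g : absoluteGaloisGroup K) (P : geomTorsion (W.baseChange K) (p : ℤ)),
      φ (g • P) = g • φ P) :
    ∃ c : ℤ, ∀ P : geomTorsion (W.baseChange K) (p : ℤ), φ P = c • P := by
  haveI : W.IsElliptic := hyp.isElliptic
  exact exists_forall_eq_zsmul_baseChange_of_ordinary hyp.p_ne_two hyp.ordinary.1 hyp.ordinary.2
    hyp.isImaginaryQuadratic.1 hyp.not_dvd_discr hirr φ hφ

end Literature.NumberTheory.EllipticCurves

end
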